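import Summits.QuantumFields.BalabanUV.T4Continuum.Support.OutputRateTowerInstance
import Summits.QuantumFields.BalabanUV.T4Continuum.Support.ColourCovariantLaplacian

/-!
# OutputRateTowerInstanceCovariant — row NE5's wall W1 INSTANTIATED for the NON-ABELIAN COVARIANT-LAPLACIAN perturbation of
# Bałaban's vector layer: the socket's `TowerLaw` and the row-NE5 END face for operator species read from the (colour-lifted)
# King-averaged towers of `(Δ_a^{(k)} ⊗ 1 + t·(Δ^{R_k} − Δ^1 ⊗ 1))⁻¹`, with row NE2's `PerturbationLaws` DISCHARGED for that
# perturbation by row NE2's theorem `ColourCovariantLaplacian.perturbationLaws_colourCovariantLaplacian` (cell `pub-balaban`, T⁴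
# fan-out, `HOME/BINDER-OWNERS.md` row NE5, owner lineage t4-ne5-p1, gen 28; LEAN PLACEMENT RULE 2026-08-19: our work under `Summits/`)

HONEST FRAMING (T4-DAG PAGE 1).  Rung (B)+1 on ONE finite four-torus of fixed physical size: existence AND uniqueness of the ε → 0
limit of gauge-invariant observables — NOT infinite volume, NOT a mass gap, NOT the Clay problem.  NE5 (`T4OutputRate.NE5`) is NOT
PRINTED ([Balaban1987RG1]–[Balaban1989LargeFieldII] print ε-UNIFORM BOUNDS, never two-spacing RATES; cell GAPS G-t4-U3-1) and NOT
PROVED here or anywhere in the tree; spine estimates PROVED 0/9, unchanged.  Row NE2's honest scope for the covariant Laplacian is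
inherited VERBATIM (`ColourCovariantLaplacian` header): MODEL LEVEL — colour transporters `R_ν(x) ∈ M_o(ℂ)` are DATA (no group
structure used), GLOBAL small field (`κ_col < 1` at the physical coupling), ONLY the covariant-Laplacian summand of `Δ_a` is
covariantized (the `−∂P∂*`/`aQ*Q` parts are not), finite torus, linear (vector) layer, operator norm, constants OURS with the crude
colour factor `(card o)²`; NOT [Balaban1985BackgroundPropagators] (3.23)–(3.24) as printed; the entrywise `LipschitzBackground` /
`BoundedBackground` hypotheses on the connection fields `−w = Vab R` and the zeroth-order fields `z = Zab R` are HYPOTHESES ON DATA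
(displayed binders `hV`, `hz`).  Every `StepModel`, every reading map and every other wall of row NE5 is ABSTRACT DATA /
HYPOTHESIS SHAPE consumed BY NAME; nothing of Bałaban's text is asserted; 0 cite tags.  `FlowStep.BetaPertH`, (B), (B^μ) do not
occur here and are NOT hidden.  HONEST DEPENDENCY (cell, verbatim): continuum YM on T⁴ ⇐ BetaPertH ∧ nine spine estimates (0/9
proved); BetaPertH ⇐ (D1) ∧ (D4) ∧ CAP+tail; G-an2-4 gates asym, D1 and NE2/3/4.

WHAT THIS MODULE IS.  `OutputRateTowerInstance` (gen 27, p205877/p206294) instantiated W1's carrier law from row NE2's resolvent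
route with ONE binder of NE2 type per background index — `PerturbationLaws D (P j) Jinj κ (e₂ j)` — and discharged it for King's
planted unit-lattice potentials (`towerLaw_plantedPotential`).  Row NE2 (lineage P1 gen 9, files 14/18/19) has since PROVED
`PerturbationLaws` for the perturbation `P = Δ^{R} − Δ^1 ⊗ 1` (the non-abelian covariant vector Laplacian minus the free one, on
`(sites × components) × colours`) against the colour-LIFTED free tower `Δ_a ⊗ 1`, `Q ⊗ 1`, `J ⊗ 1`
(`KroneckerLift.freeTowerLaws_kron ∘ NE2PerturbedLayer.freeTowerLaws_king`).  Here, BY NAME: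
* §1 `C2col_nonneg`; **`towerLaw_colourCovariantLaplacian`** — for every FAMILY `R j` of colour-transporter fields (one per background
  index `j`) whose connection / zeroth-order coefficient towers are entrywise `LipschitzBackground (α, β)` / `BoundedBackground
  (α′, β′)`, and every coupling `‖t‖·κ_col < 1`: the socket's `TowerLaw` for the perturbed lifted towers with constant
  `Cpert κ_col (2dCst) CJ C₂^col 0 t` and rate `L^{−1}` — NO binder of NE2 type left (`towerLaw_perturbed` with
  `hfree := freeTowerLaws_kron o freeTowerLaws_king`, `hpert := perturbationLaws_colourCovariantLaplacian`); the physical coupling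
  `t = 1` under `κ_col < 1` (`towerLaw_colourCovariantLaplacian_one`); W1 in margin units `operatorRate_of_colourCovariantLaplacian_floor`.
* §2 **ROW NE5's END FOR THE COVARIANT-LAPLACIAN CLASS** `ne5_at_of_colourCovariantLaplacian_lip_readsIns_nat`: for operator species an
  instantiation reads (`ReadsTower`, constant `cR`) from those towers, NE5 follows from the reading, the [I]-type floor, MI-R, W2,
  W2-ins (+ `InsBoundA`), W3, `ReadsIns`, R, S — and the DATA hypotheses `hV`, `hz`, `‖t‖κ_col < 1`; NO η-rate law binder and NO
  binder of NE2 type.  Conclusion `T4OutputRate.NE5` LITERALLY.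
EFFECT ON THE ROW (census): W1's instantiated scope moves from «planted unit-lattice potentials / first-order Lipschitz backgrounds»
to «the covariant-Laplacian summand of Bałaban's `Δ_a(U)` with colour transporters as data» — the nearest instance in the tree to
leaf L12 of `SKELETON-NE5-P1`; OPEN for Bałaban's full covariant `Δ_a(U)` (the `−∂P∂*`/`aQ*Q` covariantization, row NE2) and for
the READING `ReadsTower` of his step (leaf L07r).  No wall is discharged from print; S and the exponent untouched; NE5 NOT PROVED;
spine 0/9; rung (B)+1 finite T⁴; NOT infinite volume / mass gap / Clay.  0 sorry; axioms ⊆ {propext, Classical.choice, Quot.sound}.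
-/

noncomputable section

open Set Metric
open scoped Matrix Matrix.Norms.L2Operator Kronecker

namespace Summit.QuantumFields.BalabanUV.T4Continuum.OutputRateTowerInstanceCovariant

open Literature.MathematicalPhysics.QuantumFieldTheory.Balaban1983to89
open Literature.MathematicalPhysics.QuantumFieldTheory.Balaban1983to89.T4OutputRate
open Literature.MathematicalPhysics.QuantumFieldTheory.Balaban1983to89.T4InputCauchyRateData
open Literature.MathematicalPhysics.QuantumFieldTheory.Balaban1983to89.B5Prop11Plancherel (Cst Cst_nonneg)
open Summit.QuantumFields.BalabanUV.T4Continuum.CovariantAveragingTower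
open Summit.QuantumFields.BalabanUV.T4Continuum.BackgroundResolventTower
open Summit.QuantumFields.BalabanUV.T4Continuum.OutputRateInsertion
open Summit.QuantumFields.BalabanUV.T4Continuum.OutputRateTowerSocket
open Summit.QuantumFields.BalabanUV.T4Continuum.OutputRateTowerInstance
open Summit.QuantumFields.BalabanUV.T4Continuum.BalabanAveragedTowerUnit (idx Qlev)
open Summit.QuantumFields.BalabanUV.T4Continuum.KingPairingPlantedLaw (calDalev JpcT CJ CJ_nonneg)
open Summit.QuantumFields.BalabanUV.T4Continuum.NE2PerturbedLayer (freeTowerLaws_king)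
open Summit.QuantumFields.BalabanUV.T4Continuum.FirstOrderBackgroundModel (LipschitzBackground C2model)
open Summit.QuantumFields.BalabanUV.T4Continuum.FirstOrderAdjointModel (C2adj C2adj_nonneg)
open Summit.QuantumFields.BalabanUV.T4Continuum.PerturbationAlgebra (BoundedBackground)
open Summit.QuantumFields.BalabanUV.T4Continuum.KroneckerLift (freeTowerLaws_kron)
open Summit.QuantumFields.BalabanUV.T4Continuum.ColourCovariantLaplacian (kappaCol C2col covPertC Vab Zab
  perturbationLaws_colourCovariantLaplacian)

/-! ## §1 The socket's `TowerLaw` for the covariant-Laplacian perturbation of the lifted King towers -/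

section Law

variable {d : ℕ} {o : Type*} [Fintype o] [DecidableEq o] (L : ℕ) [NeZero L] (M : Fin d → ℕ) [∀ μ, NeZero (M μ)] (a : ℝ)
  (ha : 0 < a)

omit [DecidableEq o] [NeZero L] [∀ μ, NeZero (M μ)] in
/-- `C₂^col ≥ 0` for non-negative regularity constants. [folklore] -/
theorem C2col_nonneg {α β β' : ℝ} (hα : 0 ≤ α) (hβ : 0 ≤ β) (hβ' : 0 ≤ β') : 0 ≤ C2col o d L a α β β' := by
  have hC := Cst_nonneg d a
  have h1 : 0 ≤ C2model d L a α β := by unfold C2model; positivity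
  have h2 : 0 ≤ C2adj d L a α β := C2adj_nonneg d L a hα hβ
  unfold C2col
  positivity

/-- **`TowerLaw` FOR THE COVARIANT-LAPLACIAN PERTURBATION** (`d ≥ 1`): for every family `R j` of colour-transporter fields along
the tower whose connection coefficient towers `Vab (R j) p` are `LipschitzBackground (α, β)` and zeroth-order towers `Zab (R j) p`
are `BoundedBackground (α′, β′)` for every matrix unit `p`, and every coupling `‖t‖·κ_col < 1`, the perturbed lifted King towers
`(Δ_a^{(k)} ⊗ 1 + t·(Δ^{R_{j,k}} − Δ^1 ⊗ 1))⁻¹` obey the socket's `TowerLaw` with ONE constant `Cpert κ_col (2dCst) CJ C₂^col 0 t`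
and rate `L^{−1}` — NO binder of NE2 type: `hfree := freeTowerLaws_kron o freeTowerLaws_king`,
`hpert := perturbationLaws_colourCovariantLaplacian`. [folklore] -/
theorem towerLaw_colourCovariantLaplacian (hd : 1 ≤ d) {Jx : Type*}
    {R : Jx → (k : ℕ) → Fin d → (idx L M k → Matrix o o ℂ)} {α β α' β' : ℝ}
    (hV : ∀ j (p : o × o), LipschitzBackground L M (Vab L M (R j) p) α β)
    (hz : ∀ j (p : o × o), BoundedBackground L M (Zab L M (R j) p) α' β') {t : ℂ} (ht : ‖t‖ * kappaCol o d a α β α' < 1) :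
    TowerLaw (fun _ : Jx => fun k => Qlev L M k ⊗ₖ (1 : Matrix o o ℂ))
      (pertTower (fun k => calDalev L M a ha k ⊗ₖ (1 : Matrix o o ℂ)) (fun j => covPertC L M (R j)) t) ((L : ℝ) ^ d)
      (Cpert (kappaCol o d a α β α') (2 * d * Cst d a) (CJ d a) (C2col o d L a α β β') 0 t) ((L : ℝ)⁻¹) := by
  have hr : (0 : ℝ) < (L : ℝ) ^ d := pow_pos (by exact_mod_cast Nat.pos_of_ne_zero (NeZero.ne L)) d
  exact towerLaw_perturbed hr (freeTowerLaws_kron o (freeTowerLaws_king L M a ha))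
    (fun j => perturbationLaws_colourCovariantLaplacian L M a ha hd (hV j) (hz j)) (fun _ => le_rfl) (fun _ => le_rfl)
    (fun _ _ => le_rfl) (fun _ => by simp) ht

/-- **THE PHYSICAL COUPLING `t = 1`** in the small-field regime `κ_col < 1`: the towers of `(Δ_a^{(k)} ⊗ 1 + (Δ^{R_{j,k}} − Δ^1 ⊗ 1))⁻¹`
obey the socket's `TowerLaw` with constant `Cpert κ_col (2dCst) CJ C₂^col 0 1`, rate `L^{−1}`. [folklore] -/
theorem towerLaw_colourCovariantLaplacian_one (hd : 1 ≤ d) {Jx : Type*}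
    {R : Jx → (k : ℕ) → Fin d → (idx L M k → Matrix o o ℂ)} {α β α' β' : ℝ}
    (hV : ∀ j (p : o × o), LipschitzBackground L M (Vab L M (R j) p) α β)
    (hz : ∀ j (p : o × o), BoundedBackground L M (Zab L M (R j) p) α' β') (hsmall : kappaCol o d a α β α' < 1) :
    TowerLaw (fun _ : Jx => fun k => Qlev L M k ⊗ₖ (1 : Matrix o o ℂ))
      (pertTower (fun k => calDalev L M a ha k ⊗ₖ (1 : Matrix o o ℂ)) (fun j => covPertC L M (R j)) 1) ((L : ℝ) ^ d)
      (Cpert (kappaCol o d a α β α') (2 * d * Cst d a) (CJ d a) (C2col o d L a α β β') 0 1) ((L : ℝ)⁻¹) :=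
  towerLaw_colourCovariantLaplacian L M a ha hd hV hz (t := 1) (by rwa [norm_one, one_mul])

variable {C : Carriers} {Op Hist : Type*} [NormedAddCommGroup Op] [NormedSpace ℂ Op] [NormedAddCommGroup Hist]
  [NormedSpace ℂ Hist] (Mdl : StepModel C Op Hist)

/-- **W1 IN MARGIN UNITS FOR THE COVARIANT-LAPLACIAN CLASS**: reading `ReadsTower` (constant `cR`) from the perturbed lifted towers +
an [I]-type margin floor `r₀ ≤ rOp k` ⟹ `StepModel.OperatorRate W (cR·Cpert(…, t)/r₀) L^{−1}` — the rate is row NE2's theorem, the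
only U ≠ 1 inputs are the DATA hypotheses `hV`, `hz`, `‖t‖κ_col < 1` (`α, β, β′ ≥ 0` for the sign of `C₂^col`). [folklore] -/
theorem operatorRate_of_colourCovariantLaplacian_floor (hd : 1 ≤ d) {Jx : Type*}
    {R : Jx → (k : ℕ) → Fin d → (idx L M k → Matrix o o ℂ)} {α β α' β' : ℝ} (hα : 0 ≤ α) (hβ : 0 ≤ β) (hβ' : 0 ≤ β')
    (hV : ∀ j (p : o × o), LipschitzBackground L M (Vab L M (R j) p) α β)
    (hz : ∀ j (p : o × o), BoundedBackground L M (Zab L M (R j) p) α' β') {t : ℂ} (ht : ‖t‖ * kappaCol o d a α β α' < 1)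
    {W : Set (ℕ → ℝ)} {cR r₀ : ℝ} {tow : ℕ → (ℕ → ℝ) → C.BgB → Jx}
    (hread : ReadsTower Mdl (fun _ : Jx => fun k => Qlev L M k ⊗ₖ (1 : Matrix o o ℂ))
      (pertTower (fun k => calDalev L M a ha k ⊗ₖ (1 : Matrix o o ℂ)) (fun j => covPertC L M (R j)) t) ((L : ℝ) ^ d) W cR tow)
    (hcR : 0 ≤ cR) (hfl : ∀ k, r₀ ≤ Mdl.rOp k) (hr₀ : 0 < r₀) :
    Mdl.OperatorRate W (cR * Cpert (kappaCol o d a α β α') (2 * d * Cst d a) (CJ d a) (C2col o d L a α β β') 0 t / r₀)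
      ((L : ℝ)⁻¹) := by
  have hL : (0 : ℝ) < L := by exact_mod_cast Nat.pos_of_ne_zero (NeZero.ne L)
  have hr : (0 : ℝ) < (L : ℝ) ^ d := pow_pos hL d
  have hC₀ : (0 : ℝ) ≤ 2 * d * Cst d a := by have := Cst_nonneg d a; positivity
  exact operatorRate_of_perturbed_floor Mdl hr (freeTowerLaws_kron o (freeTowerLaws_king L M a ha))
    (fun j => perturbationLaws_colourCovariantLaplacian L M a ha hd (hV j) (hz j)) (fun _ => le_rfl) (fun _ => le_rfl)
    (fun _ _ => le_rfl) (fun _ => by simp) hC₀ (CJ_nonneg d a) (C2col_nonneg L a hα hβ hβ') le_rfl (inv_pos.mpr hL).le ht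
    hread hcR hfl hr₀

end Law

/-! ## §2 Row NE5's END face for the covariant-Laplacian class (W4 produced; NO binder of NE2 type, NO η-rate law binder) -/

section End

variable {d : ℕ} {o : Type*} [Fintype o] [DecidableEq o] (L : ℕ) [NeZero L] (M : Fin d → ℕ) [∀ μ, NeZero (M μ)] (a : ℝ)
  (ha : 0 < a)
variable {C : Carriers} {Op Hist : Type*} [NormedAddCommGroup Op] [NormedSpace ℂ Op] [NormedAddCommGroup Hist]
  [NormedSpace ℂ Hist] [CompleteSpace Hist] (Mdl : StepModel C Op Hist)

/-- **ROW NE5's END FOR THE COVARIANT-LAPLACIAN CLASS.**  For operator species an instantiation reads (`ReadsTower`, constant `cR`)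
from the colour-lifted King-averaged towers of `(Δ_a^{(k)} ⊗ 1 + t·(Δ^{R_{j,k}} − Δ^1 ⊗ 1))⁻¹` — one colour-transporter field `R j`
per background index `j`, connection / zeroth-order coefficient towers entrywise `LipschitzBackground (α, β)` / `BoundedBackground
(α′, β′)`, coupling `‖t‖·κ_col < 1`: NE5 follows from the reading, the [I]-type floor, MI-R, W2, W2-ins (+ `InsBoundA`), W3, `ReadsIns`,
R, S — and nothing else; W1's constant is `δ = cR·Cpert(κ_col, 2dCst, CJ, C₂^col, 0, t)/r₀`, its rate `L^{−1}`
(`OutputRateTowerInstance.ne5_at_of_perturbed_lip_readsIns_nat` with `hfree := freeTowerLaws_kron o freeTowerLaws_king`,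
`hpert := perturbationLaws_colourCovariantLaplacian`).  Scope as in the header: MODEL LEVEL covariant-Laplacian summand with
transporters as data — NOT Bałaban's full covariant `Δ_a(U)`. [folklore] -/
theorem ne5_at_of_colourCovariantLaplacian_lip_readsIns_nat (hd : 1 ≤ d) (Ins : ℕ → Op → (C.Dom → ℝ) → Hist) {Jx : Type*}
    {R : Jx → (k : ℕ) → Fin d → (idx L M k → Matrix o o ℂ)} {α β α' β' : ℝ} (hα : 0 ≤ α) (hβ : 0 ≤ β) (hβ' : 0 ≤ β')
    (hV : ∀ j (p : o × o), LipschitzBackground L M (Vab L M (R j) p) α β)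
    (hz : ∀ j (p : o × o), BoundedBackground L M (Zab L M (R j) p) α' β') {t : ℂ} (ht : ‖t‖ * kappaCol o d a α β α' < 1)
    {W : Set (ℕ → ℝ)} {cR r₀ δ : ℝ} {tow : ℕ → (ℕ → ℝ) → C.BgB → Jx} {EA : Functional C C.BgA} {EB : Functional C C.BgB}
    {κ Λ EA₀ E₀ Gi θ' c ω ρ₀ ρ₁ Bc : ℝ} {k₀ k₁ : ℕ}
    (hread : ReadsTower Mdl (fun _ : Jx => fun k => Qlev L M k ⊗ₖ (1 : Matrix o o ℂ))
      (pertTower (fun k => calDalev L M a ha k ⊗ₖ (1 : Matrix o o ℂ)) (fun j => covPertC L M (R j)) t) ((L : ℝ) ^ d) W cR tow)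
    (hcR : 0 ≤ cR) (hfl : ∀ k, r₀ ≤ Mdl.rOp k) (hr₀ : 0 < r₀)
    (hδ : cR * Cpert (kappaCol o d a α β α') (2 * d * Cst d a) (CJ d a) (C2col o d L a α β β') 0 t / r₀ = δ)
    (hrA : Mdl.RepresentsA EA W) (hrB : Mdl.RepresentsB EB W) (hbase : Mdl.InBase EB W) (hlip : Mdl.DataLipschitz W κ Λ ρ₀)
    (hdA : DecayBound EA W EA₀ κ) (hdB : DecayBound EB W E₀ κ) (hreadI : (InsOpModel.ofStep Mdl Ins).ReadsIns W)
    (hienv : (InsOpModel.ofStep Mdl Ins).InsOpEnvelope W κ E₀ Gi) (hbdA : (InsOpModel.ofStep Mdl Ins).InsBoundA W κ E₀ Gi)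
    (hGi : 0 ≤ Gi) (hρ₁ : ρ₁ < 1) (hreach : δ * ((L : ℝ)⁻¹) ^ k₁ ≤ ρ₁) (hdamp : Mdl.InsertionDampedNat W κ c ω) (hΛ : 0 ≤ Λ)
    (hθθ' : (L : ℝ)⁻¹ ≤ θ') (hθ'1 : θ' ≤ 1) (hc : 0 ≤ c) (hω : 0 < ω)
    (hnear : (δ + (Gi * δ / (1 - ρ₁) + 2 * Gi / ((L : ℝ)⁻¹) ^ k₁)) * ((L : ℝ)⁻¹) ^ k₀ + c * (EA₀ + E₀) / (1 - ω) ≤ ρ₀)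
    (hBc : 0 ≤ Bc) (hfirst : ∀ k < k₀, EA₀ + E₀ ≤ Bc * ((L : ℝ)⁻¹) ^ k) (hsmall : ω + Λ * c < θ') :
    NE5 EA EB W κ θ'
      ((Λ * (δ + (Gi * δ / (1 - ρ₁) + 2 * Gi / ((L : ℝ)⁻¹) ^ k₁)) + Bc) * (θ' - ω) / (θ' - (ω + Λ * c))) := by
  have hL : (0 : ℝ) < L := by exact_mod_cast Nat.pos_of_ne_zero (NeZero.ne L)
  have hr : (0 : ℝ) < (L : ℝ) ^ d := pow_pos hL d
  have hC₀ : (0 : ℝ) ≤ 2 * d * Cst d a := by have := Cst_nonneg d a; positivity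
  exact ne5_at_of_perturbed_lip_readsIns_nat Mdl Ins (θ := (L : ℝ)⁻¹) (κP := kappaCol o d a α β α') (C₀ := 2 * d * Cst d a)
    (C₁ := CJ d a) (C₂ := C2col o d L a α β β') (Cf := 0) hr (freeTowerLaws_kron o (freeTowerLaws_king L M a ha))
    (fun j => perturbationLaws_colourCovariantLaplacian L M a ha hd (hV j) (hz j)) (fun _ => le_rfl) (fun _ => le_rfl)
    (fun _ _ => le_rfl) (fun _ => by simp) hC₀ (CJ_nonneg d a) (C2col_nonneg L a hα hβ hβ') le_rfl ht hread hcR hfl hr₀ hδ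
    hrA hrB hbase hlip hdA hdB hreadI hienv hbdA hGi hρ₁ hreach hdamp hΛ (inv_pos.mpr hL) hθθ' hθ'1 hc hω hnear hBc hfirst
    hsmall

end End

end Summit.QuantumFields.BalabanUV.T4Continuum.OutputRateTowerInstanceCovariant

end
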